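import Summits.BirchSwinnertonDyer.BirchSwinnertonDyer.Theses.FrozenTwin
import Summits.BirchSwinnertonDyer.BirchSwinnertonDyer.Theses.ToricShedding
import Summits.BirchSwinnertonDyer.BirchSwinnertonDyer.Theses.DefiniteTheta
import Literature.NumberTheory.EllipticCurves.HeegnerModuleIndex
import Literature.NumberTheory.EllipticCurves.QuadraticTwist
import Literature.NumberTheory.EllipticCurves.QuadraticTwistSelmerPInfty
import Literature.NumberTheory.EllipticCurves.LFunctionSmulProofs
import Literature.NumberTheory.EllipticCurves.BSDSelmerParityDokchitserProofs
import Literature.NumberTheory.EllipticCurves.BSDSelmerParityDokchitserBaseChangeProofs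
import Summits.BirchSwinnertonDyer.BirchSwinnertonDyer.Theorems.ToricSheddingUBPotentiallyGoodStubTwistAdmissible
import HarnessLib

/-!
# Line `Sketch` (crux idea `heegner-index-sharpness`) — skeleton for crux `UBPotentiallyGood`
# (stmt-BirchSwinnertonDyer-15878), lead prover's copy

Crux (route FrozenTwin #4 = ToricShedding #5 = DefiniteTheta #4, byte-identical decls): the
POTENTIALLY-GOOD SECTOR of the Selmer-rank upper bound — for `E/ℚ` (globally minimal `W`) with NO
prime of multiplicative reduction and every good ordinary `p ≥ 5` with `ρ̄_{E,p}` surjective,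
`corank_{ℤ_p} Sel_{p^∞}(E/ℚ) ≤ ord_{s=1} L(E,s)`.

## The cut: the vertical Heegner tower (Ideas/heegner-index-sharpness.md)

For a Heegner field `K` of `E` (every prime of `N` SPLIT — additive primes of any exponent are
allowed, so every curve of the sector has infinitely many), the anticyclotomic `ℤ_p`-tower `K_∞/K`
and Howard's `Λ`-adic Heegner class, the `(γ-1)`-adic index `a(E,K,p) = heegnerModuleIndex D F`
caps the Selmer corank over `K`: `corank Sel_{p^∞}(E/K) ≤ 1 + 2·a` (Howard 2004 §1 eq. (2), tree
fact `Howard2004_selmerCorank_le`). With the PROVED quadratic additivity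
`corank(E/K) = corank(E/ℚ) + corank(E^{d_K}/ℚ)` (`selmerCorank_baseChange_quadratic_holds`) and GZK
for the twist (`r_an(E^{d_K}) ≤ 1 ⇒ corank(E^{d_K}) = r_an(E^{d_K})`) this gives
`corank(E/ℚ) ≤ 1 + 2a − r_an(E^{d_K}) ≤ r_an(E)` as soon as ONE `K` has a SHARP index,
`1 + 2a ≤ r_an(E) + r_an(E^{d_K})`.

Stubs (six; skeleton v3 — reshaped by the lead, v1→v2 2026-08-17T19:40Z and v2→v3 20:30Z, see
"Reshape" below;
`stub_gzkRange` is byte-identical to the GZK stub of lines `birth` / `kurihara_depth`):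
* **GZK** `stub_gzkRange` (LITERATURE DEBT): `r_an ≤ 1 → corank_p = r_an` at every prime
  (Gross–Zagier–Kolyvagin + the proved corank identity; tree fact
  `rank_eq_analyticRank_of_analyticRank_le_one`, pointer `stub_gzkRange_of_fact`; itemised in
  `Theorems/ToricSheddingUBPotentiallyGoodStubGzkRange.lean`, p172884).
* **HOWARD** `stub_howardBound` (LITERATURE DEBT): the universal closure of the tree fact
  `Howard2004_selmerCorank_le N W K p κ γ jbar` (Howard, Compositio 140 (2004), §1 eq. (2));
  reduced in tree to the single fact `Howard2004_thmB`
  (`Theorems/ToricSheddingUBPotentiallyGoodStubHowardBound.lean`, p173034).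
* **LB** `stub_selmerRankLB` (SHARED OPEN ITEM, verbatim the body of the routes' binder
  `SelmerRankLB`, stmt-BirchSwinnertonDyer-0131; known for `r_an ≤ 3`): the lower bound
  `r_an ≤ corank_p` at big-image good ordinary `p ≥ 5` — consumed ONLY for the quadratic twist
  `E^{d_K}` when `r_an(E^{d_K}) ≥ 2` (for `r_an(E^{d_K}) ≤ 1` GZK serves), pointer
  `stub_selmerRankLB_of_item`.
* **ADM** `stub_twistAdmissible` (LANDED p173810, `Theorems.stub_twistAdmissible`): for `W` in the
  crux's block at `p` and an integer `d ≠ 0` with `p ∤ d`, some global minimal model `C • W^{(d)}` of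
  the twist is again good ordinary with surjective `ρ̄` at `p`; feeds the twist to LB.
* **HYP** `stub_howardHypothesesOfCrux` (TRUE, size L — Galois image; = line VerticalKolyvaginBound/
  birth's B1 with its `Admissible` unfolded): the crux's block at `p` (`p ≥ 5` good, `p ∤ a_p`, `ρ̄`
  onto) and the `K`-side arithmetic of a Heegner datum (`K` imaginary quadratic, Heegner for `N`,
  `d_K ∉ {−3,−4}`, `p ∤ N d_K h_K`, `κ` anticyclotomic with generator `γ`) discharge
  `HowardHypotheses N W K p κ γ`: the one real step is `Γ_K ↠ Aut_{ℤ_p}(T_p E)` from `ρ̄_{E,p}` onto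
  at `p ≥ 5` (Serre's lemma, *Abelian ℓ-adic representations* IV-23 Lemma 3) and `K ⊄ ℚ(E[p^∞])`
  (`K` ramifies at some `ℓ ∤ Np`, where `ℚ(E[p^∞])` is unramified: Néron–Ogg–Shafarevich); the
  other fields are `isOrdinaryAt_iff`-level bookkeeping.
* **SHARP** `stub_balancedIndexSharp` (OPEN, load-bearing): in the crux's hypothesis block and the
  regime `2 ≤ r_an(E)`, SOME Heegner datum `(K, κ, γ, jbar, N, D, F)` with the `K`-side arithmetic
  above has a SHARP index: `1 + 2·a(E,K,p) ≤ r_an(E) + r_an(E^{d_K})`.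

`UBPotentiallyGood_of : stub_gzkRange → stub_howardBound → stub_selmerRankLB →
stub_twistAdmissible → stub_howardHypothesesOfCrux → stub_balancedIndexSharp →
FrozenTwin.UBPotentiallyGood` (sorry-free): `r_an ≤ 1` → GZK; else SHARP gives the datum, HYP
Howard's hypotheses for it, HOWARD the bound over `K` (cast `ℕ∞ → ℕ`), the
PROVED additivity splits it, and the twist's summand is bounded below by GZK (`r_an(E^{d_K}) ≤ 1`)
or by LB on the admissible minimal model of ADM, transported back by the PROVED invariances
`analyticRank_smul` / `selmerCorank_eq_of_variableChange`; `omega`. The `…ToricShedding` /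
`…DefiniteTheta` variants conclude the other two byte-identical decls.

RESHAPE (v1 → v2). v1's open stub `stub_indexSharp` demanded `r_an(E^{d_K}) ≤ 1` AND
`1 + 2a ≤ r_an(E) + r_an(E^{d_K})`. By the anti-equivariance of the anticyclotomic height
(Bertolini–Darmon 1996 indefinite conjecture = Agboola–Castella 2021 Conj. 1.1; Castella–Hsu–Kundu–
Lee–Liu arXiv:2308.10474 Conj. 1.1(ii)/Thm. 1.5(ii): `ord_J = 2(max{r⁺,r⁻} − 1)`) the index is
expected to be `a = max(r_an(E), r_an(E^{d_K})) − 1`, so Howard's `1 + 2a` is sharp ONLY for BALANCED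
pairs `|r_an(E) − r_an(E^{d_K})| = 1`; with `r_an(E^{d_K}) ≤ 1` forced, v1's stub was satisfiable
only in the cell `r_an(E) = 2` and EXPECTED FALSE for every sector curve with `r_an(E) ≥ 3` — a
misstatement (same shape as the idea card's `IndexSharp`). v2 drops `r_an(E^{d_K}) ≤ 1` from SHARP
and pays for the twist's lower bound at `r_an(E^{d_K}) ≥ 2` with the routes' own shared binder LB
(through ADM), exactly as route VerticalHeegnerOrder does (its X3 `BalancedHeegnerTwist`). v3 moves Howard's
standing hypotheses OUT of the open stub into the true stub HYP (a different body of mathematics: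
Galois images), so that SHARP quantifies only over the arithmetic of `K` and the index.

HONEST STATUS OF SHARP. It is the crux plus a balanced-Heegner-field supply with ONE
anticyclotomic-height genericity (`∃K`): under BSD-rank + `Ш[p^∞]` finite + a balanced Heegner `K`
with `p ∤ d_K h_K` and maximally non-degenerate `h_p`, SHARP holds (AC21 Thm 1.3 / CHKLL Thm 1.5 +
BCK21); conversely SHARP ⟹ crux (modulo LB for the twist) is this file. No printed theorem bounds the
Heegner index by the ANALYTIC rank at `r_an ≥ 2` (every order-of-vanishing statement in print —
CHKLL Thm 1.5(ii), AC21 Thm 6.12 — is keyed to the Selmer ranks `r^±`): the wall [W] is not breached;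
SHARP is the vertical-Heegner analogue of line `birth`'s ORD at order 2. Recorded, not hidden.

Disproof used: none on file (no `Disproof.lean` for this crux; `ledger crux ls`, 2026-08-17T18:15Z).
Negatives index: `LeadingTermTamePinch_refuted` (a prime-SUPPLY statement for CM curves) — no stub
here supplies a prime; SHARP supplies a FIELD under a surjectivity hypothesis no CM curve meets.
-/

set_option linter.dupNamespace false

namespace Summit.BirchSwinnertonDyer.BirchSwinnertonDyer.Cruxes.UBPotentiallyGood.Sketch

open Summit.BirchSwinnertonDyer.BirchSwinnertonDyer.Theses.FrozenTwin (UBPotentiallyGood)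
open Literature.NumberTheory.EllipticCurves

/-! ### Registered stubs -/

/-- Stub **GZK** (literature debt, image-free, every prime): if `ord_{s=1} L(E,s) ≤ 1` then
`corank_{ℤ_p} Sel_{p^∞}(E/ℚ) = ord_{s=1} L(E,s)` — Gross–Zagier–Kolyvagin (`rank = r_an` and
`Ш(E/ℚ)` finite) with the proved corank identity `corank Sel_{p^∞} = rank + corank Ш[p^∞]`.
In tree modulo the named fact `rank_eq_analyticRank_of_analyticRank_le_one`
(`stub_gzkRange_of_fact`). Byte-identical to the GZK stub of lines `birth` / `kurihara_depth`.
[cite: Darmon2004, Thm. 3.22] -/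
theorem stub_gzkRange :
    ∀ (W : WeierstrassCurve ℚ) [W.IsElliptic] (p : ℕ) [Fact p.Prime],
      W.analyticRank ≤ 1 → W.selmerCorank p = W.analyticRank := by
  sorry

/-- Stub **HOWARD** (literature debt): Howard's Kolyvagin bound at the trivial character, as the
universal closure of the tree fact `Howard2004_selmerCorank_le` — for `E/ℚ` (globally minimal `W`),
a number field `K`, a prime `p`, a `ℤ_p`-extension `κ` of `K` with chosen generator `γ`, an
embedding `jbar : K̄ → ℂ` and a level `N`: under `HowardHypotheses N W K p κ γ` (K imaginary
quadratic Heegner for `N`, `d_K ∉ {-3,-4}`, `p` odd, `p ∤ N d_K h_K`, `Γ_K ↠ Aut(T_p E)`, good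
ordinary, `κ` anticyclotomic, `γ` a topological generator), for every `Λ`-adic Selmer datum `D`
and Heegner family `F`, `corank_{ℤ_p} Sel_{p^∞}(E/K) ≤ 1 + 2 · heegnerModuleIndex D F` in `ℕ∞`.
Howard, Compositio Math. 140 (2004), §1 eq. (2) (Thm. B (c) + control).
[cite: Howard2004HeegnerKolyvagin, §1 eq. (2)] -/
theorem stub_howardBound :
    ∀ (N : ℕ) [NeZero N] (W : WeierstrassCurve ℚ) [W.IsGloballyMinimal] (K : Type) [Field K]
      [NumberField K] (p : ℕ) [Fact p.Prime] (κ : ZpExtension K p)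
      (γ : Field.absoluteGaloisGroup K) (jbar : AlgebraicClosure K →+* ℂ),
      Howard2004_selmerCorank_le N W K p κ γ jbar := by
  sorry

/-- Stub **LB** (shared open item, verbatim the body of `Theses.FrozenTwin.SelmerRankLB` =
`ToricShedding.SelmerRankLB` = `DefiniteTheta.SelmerRankLB`, stmt-BirchSwinnertonDyer-0131): the
LOWER bound half of `p^∞`-Selmer BSD at a big-image good ordinary prime — for `E/ℚ` (globally
minimal `W`) and `p ≥ 5` good ordinary with `ρ̄_{E,p}` surjective, `ord_{s=1} L(E,s) ≤ corank_{ℤ_p}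
Sel_{p^∞}(E/ℚ)`. Known for `r_an ≤ 3` (Skinner–Urban 2014 Thm 2, Skinner 2020 Thm A, p-parity
Dokchitser–Dokchitser 2010 Thm 1.4, Burungale–Castella–Skinner 2025); OPEN from `r_an = 4`. Consumed
here only for the quadratic twist `E^{d_K}` of the Heegner field when `r_an(E^{d_K}) ≥ 2`; pointer
`stub_selmerRankLB_of_item`. [cite: DokchitserDokchitserAnnals2010, Thm. 1.4] -/
theorem stub_selmerRankLB :
    ∀ (W : WeierstrassCurve ℚ) [W.IsElliptic] [W.IsGloballyMinimal] (p : ℕ) [Fact p.Prime],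
      5 ≤ p → W.HasGoodReductionAtPrime p → ¬ (p : ℤ) ∣ W.frobeniusTrace p →
        W.HasSurjectiveModNGaloisRep p → W.analyticRank ≤ W.selmerCorank p := by
  sorry

/-- Stub **ADM** (LANDED — `Theorems.stub_twistAdmissible`, p173810; kept here by name for the
skeleton gate): ADMISSIBILITY IS TWIST-STABLE.
For `E/ℚ` (globally minimal `W`), a prime `p ≥ 5` of good reduction with `p ∤ a_p` and `ρ̄_{E,p}`
surjective, and an integer `d ≠ 0` with `p ∤ d`, the quadratic twist `E^{(d)}` has a global
minimal model `C • W^{(d)}` (Néron; tree theorem `hasGlobalMinimalModel_rat_holds`) which is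
again of good reduction at `p` (`p ∤ 2d`), ordinary (`a_p(E^d) = (d/p)·a_p(E)`, tree theorem
`frobeniusTrace_quadraticTwist_holds` for squarefree `d`; `E^{(dc²)} ≅ E^{(d)}`) and has
surjective mod-`p` representation (`ρ̄_{E^d,p} ≅ ρ̄_{E,p} ⊗ χ_d`: its image contains
`ρ̄_{E,p}(Γ_{ℚ(√d)}) ⊇ SL₂(𝔽_p)` for `p ≥ 5` and has surjective determinant). Silverman AEC X.2,
X.6, Exercise 10.16; Rubin–Silverberg 2002 §1; Serre 1972 §2. [cite: RubinSilverberg2002, §1] -/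
theorem stub_twistAdmissible :
    ∀ (W : WeierstrassCurve ℚ) [W.IsElliptic] [W.IsGloballyMinimal] (p : ℕ) [Fact p.Prime],
      5 ≤ p → W.HasGoodReductionAtPrime p → ¬ (p : ℤ) ∣ W.frobeniusTrace p →
        W.HasSurjectiveModNGaloisRep p → ∀ (d : ℤ), d ≠ 0 → ¬ (p : ℤ) ∣ d →
          ∃ (C : WeierstrassCurve.VariableChange ℚ)
            (_ : (C • W.quadraticTwist (d : ℚ)).IsGloballyMinimal),
            (C • W.quadraticTwist (d : ℚ)).HasGoodReductionAtPrime p ∧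
              ¬ (p : ℤ) ∣ (C • W.quadraticTwist (d : ℚ)).frobeniusTrace p ∧
                (C • W.quadraticTwist (d : ℚ)).HasSurjectiveModNGaloisRep p :=
  Summit.BirchSwinnertonDyer.BirchSwinnertonDyer.Theorems.stub_twistAdmissible

/-- Stub **HYP** (true; Galois image, size L): THE CRUX'S BLOCK DISCHARGES HOWARD'S STANDING
HYPOTHESES. For `E/ℚ` (globally minimal `W`), a prime `p ≥ 5` of good reduction with `p ∤ a_p` and
`ρ̄_{E,p}` surjective, a number field `K` that is imaginary quadratic and Heegner for a level `N`
with `d_K ∉ {−3, −4}`, `p ∤ N`, `p ∤ d_K`, `p ∤ h_K`, and an anticyclotomic `ℤ_p`-extension `κ` of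
`K` with topological generator `γ`: `HowardHypotheses N W K p κ γ` holds. Field by field: `isElliptic`,
`isImaginaryQuadratic`, `discr_ne`, `heegner`, `not_dvd_level`, `not_dvd_discr`,
`not_dvd_classNumber`, `anticyclotomic`, `topGenerator` are the hypotheses; `p_ne_two` from `5 ≤ p`;
`ordinary : IsOrdinaryAt W p` from good reduction and `p ∤ a_p` (`isOrdinaryAt_iff`); and the one
real step `surjective` — every `ℤ_p`-linear automorphism of `T_p(E_K)` is a Galois element:
`ρ̄_{E,p}(Γ_ℚ) = GL₂(𝔽_p)` with `p ≥ 5` forces `ρ_{E,p^∞}(Γ_ℚ) = GL₂(ℤ_p)` (Serre's lemma: a closed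
subgroup of `GL₂(ℤ_p)`, `p ≥ 5`, surjecting onto `GL₂(𝔽_p)` is everything — Serre, *Abelian ℓ-adic
representations* (1968) IV-23 Lemma 3; Lang, *Elliptic Functions* Ch. 17 §4), and `Γ_K` has the
same image because `K ∩ ℚ(E[p^∞]) = ℚ`: `K` is ramified at some prime `ℓ ∣ d_K`, and `ℓ ∤ Np`
(primes of `N` split in `K`, `p ∤ d_K`), where `ℚ(E[p^∞])/ℚ` is unramified (Néron–Ogg–Shafarevich,
Silverman AEC VII.7.1). Identical in content to stub B1 `stub_howardHypotheses` of line
`Cruxes/VerticalKolyvaginBound/Lines/birth.lean` (crux stmt-BirchSwinnertonDyer-18467).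
[cite: SerreAbelianLadic1968, IV-23 Lemma 3] -/
theorem stub_howardHypothesesOfCrux :
    ∀ (W : WeierstrassCurve ℚ) [W.IsElliptic] [W.IsGloballyMinimal] (p : ℕ) [Fact p.Prime],
      5 ≤ p → W.HasGoodReductionAtPrime p → ¬ (p : ℤ) ∣ W.frobeniusTrace p →
        W.HasSurjectiveModNGaloisRep p →
          ∀ (K : Type) [Field K] [NumberField K] (κ : ZpExtension K p)
            (γ : Field.absoluteGaloisGroup K) (N : ℕ) [NeZero N],
            IsImaginaryQuadratic K → SatisfiesHeegnerHypothesis N K →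
              NumberField.discr K ≠ -3 ∧ NumberField.discr K ≠ -4 → ¬ p ∣ N →
                ¬ (p : ℤ) ∣ NumberField.discr K → ¬ p ∣ NumberField.classNumber K →
                  κ.IsAnticyclotomic → κ.IsTopGenerator γ → HowardHypotheses N W K p κ γ := by
  sorry

/-- Stub **SHARP** (OPEN — the load-bearing stub): INDEX SHARPNESS FOR ONE (BALANCED) HEEGNER FIELD.
For `E/ℚ` (globally minimal `W`) with NO prime of multiplicative reduction, a prime `p ≥ 5` of good
ordinary reduction with `ρ̄_{E,p}` surjective, and `ord_{s=1} L(E,s) ≥ 2`: there are an imaginary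
quadratic field `K`, Heegner for a level `N ≥ 1`, with `d_K ∉ {−3,−4}`, `p ∤ N d_K h_K`, an
anticyclotomic `ℤ_p`-extension `κ` of `K` with topological generator `γ`, an embedding `jbar`, a
`Λ`-adic Selmer datum `D` of `E/K` and a Heegner family `F` (parametrisation of `E` of level `N`,
orientation, norm-compatible Heegner points of conductor `p^{j+1}`) whose Heegner-module index
`a = heegnerModuleIndex D F` is SHARP: `1 + 2a ≤ ord_{s=1} L(E,s) + ord_{s=1} L(E^{(d_K)},s)`. By
Bertolini–Darmon 1996 / Agboola–Castella 2021 Conj. 1.1 / Castella–Hsu–Kundu–Lee–Liu Conj. 1.1(ii)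
(`ord_J = 2(max{r⁺,r⁻} − 1)`) together with BSD, `a = max(r_an(E), r_an(E^{d_K})) − 1`, so the
witness `K` must be BALANCED (`|r_an(E) − r_an(E^{d_K})| = 1`, which also fixes the parity
`w(E/K) = −1` of the Heegner hypothesis) with maximally non-degenerate anticyclotomic height; in the
first open cell (`r_an(E) = 2`, `w = +1`, `r_an(E^{d_K}) = 1`) sharp means `a = 1`: the `Λ`-adic
Heegner class vanishes at the trivial character to order EXACTLY one (derived Heegner point ≠ 0;
simple zero of the square-root BDP `p`-adic `L`-function). Why it might fail: only together with the
crux granting BSD-rank + `Ш[p^∞]`-finiteness + balanced-twist supply (route VerticalHeegnerOrder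
X3, open for `r_an ≥ 3`) + one generic height; as typed also if some `(E,p)` had NO balanced Heegner
`K` with `p ∤ d_K h_K` (Heegner fields with `p ∤ h_K` and prescribed local behaviour exist — Wiles
2015, Beckwith 2017 — but not, in print, simultaneously with a balanced twist rank).
[cite: AgboolaCastella2021, Conj. 1.1 and Thm. 1.3] -/
theorem stub_balancedIndexSharp :
    ∀ (W : WeierstrassCurve ℚ) [W.IsElliptic] [W.IsGloballyMinimal],
      (¬ ∃ (q : ℕ) (_ : Fact q.Prime), W.HasMultiplicativeReductionAtPrime q) →
        ∀ (p : ℕ) [Fact p.Prime], 5 ≤ p → W.HasGoodReductionAtPrime p →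
          ¬ (p : ℤ) ∣ W.frobeniusTrace p → W.HasSurjectiveModNGaloisRep p →
            2 ≤ W.analyticRank →
              ∃ (K : Type) (_ : Field K) (_ : NumberField K) (κ : ZpExtension K p)
                (γ : Field.absoluteGaloisGroup K) (jbar : AlgebraicClosure K →+* ℂ)
                (N : ℕ) (_ : NeZero N) (D : (W.baseChange K).LambdaAdicSelmerData κ γ)
                (F : HeegnerFamily N W K κ jbar) (a : ℕ),
                (IsImaginaryQuadratic K ∧ SatisfiesHeegnerHypothesis N K ∧
                  (NumberField.discr K ≠ -3 ∧ NumberField.discr K ≠ -4) ∧ ¬ p ∣ N ∧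
                  ¬ (p : ℤ) ∣ NumberField.discr K ∧ ¬ p ∣ NumberField.classNumber K ∧
                  κ.IsAnticyclotomic ∧ κ.IsTopGenerator γ) ∧
                heegnerModuleIndex D F = a ∧
                  1 + 2 * a ≤ W.analyticRank +
                    (W.quadraticTwist (NumberField.discr K : ℚ)).analyticRank := by
  sorry

/-! ### Stub statements by name (`type_of%`, as in lines `birth` / `kurihara_depth`) -/

namespace Statement

/-- Statement of `stub_gzkRange`. -/
abbrev stub_gzkRange : Prop := type_of% @Sketch.stub_gzkRange
/-- Statement of `stub_howardBound`. -/
abbrev stub_howardBound : Prop := type_of% @Sketch.stub_howardBound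
/-- Statement of `stub_selmerRankLB`. -/
abbrev stub_selmerRankLB : Prop := type_of% @Sketch.stub_selmerRankLB
/-- Statement of `stub_twistAdmissible`. -/
abbrev stub_twistAdmissible : Prop := type_of% @Sketch.stub_twistAdmissible
/-- Statement of `stub_howardHypothesesOfCrux`. -/
abbrev stub_howardHypothesesOfCrux : Prop := type_of% @Sketch.stub_howardHypothesesOfCrux
/-- Statement of `stub_balancedIndexSharp`. -/
abbrev stub_balancedIndexSharp : Prop := type_of% @Sketch.stub_balancedIndexSharp

end Statement

/-! ### The crux from the stubs (kernel-checked composition, no `sorry`) -/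

/-- **The crux BY NAME from the six stub statements** (GZK → HOWARD → LB → ADM → HYP → SHARP →
`FrozenTwin.UBPotentiallyGood`): if `r_an ≤ 1` use GZK; otherwise SHARP supplies a Heegner datum over
a field `K` with sharp index `a`, HYP gives Howard's standing hypotheses for it, HOWARD bounds `corank(E/K) ≤ 1 + 2a` (cast from `ℕ∞`),
the proved additivity splits `corank(E/K) = corank(E) + corank(E^{d_K})`, and the twist's summand
is at least `r_an(E^{d_K})` — by GZK when `r_an(E^{d_K}) ≤ 1` (the twist is elliptic since
`d_K ≠ 0`), else by LB on the admissible global minimal model `C • E^{d_K}` of ADM (`p ∤ d_K` is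
one of Howard's hypotheses), transported by `analyticRank_smul` and
`selmerCorank_eq_of_variableChange`; `omega` concludes. [folklore] -/
theorem UBPotentiallyGood_of (hGZK : Statement.stub_gzkRange) (hHow : Statement.stub_howardBound)
    (hLB : Statement.stub_selmerRankLB) (hAdm : Statement.stub_twistAdmissible)
    (hHyp : Statement.stub_howardHypothesesOfCrux) (hSharp : Statement.stub_balancedIndexSharp) :
    UBPotentiallyGood := by
  intro W _ _ hpg p _ h5 hgood hord hsurj
  by_cases h1 : W.analyticRank ≤ 1
  · exact (hGZK W p h1).le
  · have h2 : 2 ≤ W.analyticRank := by omega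
    obtain ⟨K, _, _, κ, γ, jbar, N, _, D, F, a, ⟨hIQ, hHeeg, hdisc, hpN, hpd, hph, hac, hγ⟩, ha,
      hsharp⟩ := hSharp W hpg p h5 hgood hord hsurj h2
    have hH : HowardHypotheses N W K p κ γ :=
      hHyp W p h5 hgood hord hsurj K κ γ N hIQ hHeeg hdisc hpN hpd hph hac hγ
    have hK2 : Module.finrank ℚ K = 2 := hIQ.1
    have hB := hHow N W K p κ γ jbar hH D F
    rw [ha] at hB
    have hB' : (W.baseChange K).selmerCorank p ≤ 1 + 2 * a := by exact_mod_cast hB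
    have hadd := selmerCorank_baseChange_quadratic_holds W K hK2 p
    have hd0 : NumberField.discr K ≠ 0 := NumberField.discr_ne_zero K
    have hd : (NumberField.discr K : ℚ) ≠ 0 := by exact_mod_cast hd0
    haveI := W.isElliptic_quadraticTwist hd
    -- lower bound for the twist's summand
    have htwist : (W.quadraticTwist (NumberField.discr K : ℚ)).analyticRank ≤
        (W.quadraticTwist (NumberField.discr K : ℚ)).selmerCorank p := by
      by_cases htw : (W.quadraticTwist (NumberField.discr K : ℚ)).analyticRank ≤ 1
      · exact (hGZK (W.quadraticTwist (NumberField.discr K : ℚ)) p htw).ge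
      · obtain ⟨C, hmin, hgood', hord', hsurj'⟩ :=
          hAdm W p h5 hgood hord hsurj (NumberField.discr K) hd0 hpd
        haveI := hmin
        have hlb := hLB (C • W.quadraticTwist (NumberField.discr K : ℚ)) p h5 hgood' hord' hsurj'
        rw [WeierstrassCurve.analyticRank_smul] at hlb
        rwa [← selmerCorank_eq_of_variableChange p
          (rfl : C • W.quadraticTwist (NumberField.discr K : ℚ) = _)] at hlb
    omega

/-- The crux along this line (route `FrozenTwin` decl, by name), MODULO exactly the six
registered stubs (one of them, ADM, landed) (depends on `sorryAx` only through `stub_*`). [folklore] -/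
theorem UBPotentiallyGood_proof : UBPotentiallyGood :=
  UBPotentiallyGood_of stub_gzkRange stub_howardBound stub_selmerRankLB stub_twistAdmissible
    stub_howardHypothesesOfCrux stub_balancedIndexSharp

/-- The same composition under the byte-identical decl of route `ToricShedding` (the item's primary
route), sorry-free with the stub statements as named hypotheses. [folklore] -/
theorem UBPotentiallyGood_ofToricShedding (hGZK : Statement.stub_gzkRange)
    (hHow : Statement.stub_howardBound) (hLB : Statement.stub_selmerRankLB)
    (hAdm : Statement.stub_twistAdmissible) (hHyp : Statement.stub_howardHypothesesOfCrux)
    (hSharp : Statement.stub_balancedIndexSharp) :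
    Summit.BirchSwinnertonDyer.BirchSwinnertonDyer.Theses.ToricShedding.UBPotentiallyGood :=
  fun W _ _ hpg p _ h5 hgood hord hsurj =>
    UBPotentiallyGood_of hGZK hHow hLB hAdm hHyp hSharp W hpg p h5 hgood hord hsurj

/-- The crux along this line under the `ToricShedding` decl, MODULO the six registered stubs.
[folklore] -/
theorem UBPotentiallyGood_proofToricShedding :
    Summit.BirchSwinnertonDyer.BirchSwinnertonDyer.Theses.ToricShedding.UBPotentiallyGood :=
  UBPotentiallyGood_ofToricShedding stub_gzkRange stub_howardBound stub_selmerRankLB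
    stub_twistAdmissible stub_howardHypothesesOfCrux stub_balancedIndexSharp

/-- The same composition under the byte-identical decl of route `DefiniteTheta`, sorry-free with the
stub statements as named hypotheses. [folklore] -/
theorem UBPotentiallyGood_ofDefiniteTheta (hGZK : Statement.stub_gzkRange)
    (hHow : Statement.stub_howardBound) (hLB : Statement.stub_selmerRankLB)
    (hAdm : Statement.stub_twistAdmissible) (hHyp : Statement.stub_howardHypothesesOfCrux)
    (hSharp : Statement.stub_balancedIndexSharp) :
    Summit.BirchSwinnertonDyer.BirchSwinnertonDyer.Theses.DefiniteTheta.UBPotentiallyGood :=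
  fun W _ _ hpg p _ h5 hgood hord hsurj =>
    UBPotentiallyGood_of hGZK hHow hLB hAdm hHyp hSharp W hpg p h5 hgood hord hsurj

/-- The crux along this line under the `DefiniteTheta` decl, MODULO the six registered stubs.
[folklore] -/
theorem UBPotentiallyGood_proofDefiniteTheta :
    Summit.BirchSwinnertonDyer.BirchSwinnertonDyer.Theses.DefiniteTheta.UBPotentiallyGood :=
  UBPotentiallyGood_ofDefiniteTheta stub_gzkRange stub_howardBound stub_selmerRankLB
    stub_twistAdmissible stub_howardHypothesesOfCrux stub_balancedIndexSharp

/-! ### What discharges the literature stubs (kernel-checked pointers, no `sorry`) -/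

/-- GZK is the tree fact bsd.S17 composed with the proved corank identity. [folklore] -/
theorem stub_gzkRange_of_fact (h : rank_eq_analyticRank_of_analyticRank_le_one) :
    Statement.stub_gzkRange :=
  fun W _ p _ h1 => selmerCorank_eq_analyticRank_of_analyticRank_le_one h W p h1

/-- HOWARD is, definitionally, the universal closure of the tree fact
`Howard2004_selmerCorank_le`. [folklore] -/
theorem stub_howardBound_of_fact
    (h : ∀ (N : ℕ) [NeZero N] (W : WeierstrassCurve ℚ) [W.IsGloballyMinimal] (K : Type) [Field K]
      [NumberField K] (p : ℕ) [Fact p.Prime] (κ : ZpExtension K p)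
      (γ : Field.absoluteGaloisGroup K) (jbar : AlgebraicClosure K →+* ℂ),
      Howard2004_selmerCorank_le N W K p κ γ jbar) :
    Statement.stub_howardBound := h

/-- LB is, verbatim, the routes' shared binder `SelmerRankLB` (stmt-BirchSwinnertonDyer-0131; here
the `FrozenTwin` copy — the `ToricShedding` / `DefiniteTheta` copies have the same body). [folklore] -/
theorem stub_selmerRankLB_of_item
    (h : Summit.BirchSwinnertonDyer.BirchSwinnertonDyer.Theses.FrozenTwin.SelmerRankLB) :
    Statement.stub_selmerRankLB :=
  fun W _ _ p _ h5 hgood hord hsurj => h W p h5 hgood hord hsurj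

end Summit.BirchSwinnertonDyer.BirchSwinnertonDyer.Cruxes.UBPotentiallyGood.Sketch
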